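import Summits.BirchSwinnertonDyer.Rank1Residual.ManinAdditive.CMPartnerLaw
import HarnessLib

/-!
# §45: the CM TRACE/DIFFERENT bound and the twin `Γ₁`-laws — E-es-147₂/₃, E-es-148₂, E-es-149₃ (cell `bsd-f2-manin`, planner `-es` g31; T-es-48)

TYPER NOTE (typer g20, T-es-48).  SOURCE = HOME/es/g31/Sketch-es-g31.lean sha16 65dc018b9348ec58 (227 l.; es: farm rc 0 · 0 err · 0 warn ·
0 s∗rry; BC7 4/4 CLEAN Probe-es-g31.out.txt) §45.1–§45.4 VERBATIM except this note and ONE dedup delta: es's two §45.1 glue lemmas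
`j_eq_1728_of_c₆_eq_zero` / `j_eq_zero_of_c₄_eq_zero` restate `Summit.BirchSwinnertonDyer.Rank1Residual.X12.*` (InertCoreInstancesA; gate `dedup.landed` at
dry-run) whose import cone is unrelated to this leaf — so their 5-line proofs are inlined as local `have hjV` in the three COR theorems instead.  The file continues ns `…ManinAdditive.KatoCurve.CMTwinMinimal` (parts 1–4:
`CMTwinStevensMinimal` p716468, `…NetCount` p716671, `CMPartnerLaw` p717929, `CMPartnerLawConverse` p719167).  `@[conjecture]` on the cell rows
**E-es-147₂/₃ `CMTwinGammaOneLawTwoLocal/ThreeLocal`** (twin Γ₁ partner laws, NO root / twist-reduced binder), **E-es-148₂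
`CMGammaOneRootLawTwoLocalAt256`**, **E-es-149₃ `CMGammaOneRootLawThreeLocalOff27`** (root laws on the δ = 0 strata = the p-part of Stevens' Γ₁
statement there) — es files all four as THEOREM CANDIDATES with a PAPER proof (MEMO-es §45 THEOREM 45: CM class formula + ray-class TRACE +
DIFFERENT bound; audit R-es-69 pending at landing time), so they stay `@[conjecture]` (obligation nodes) until kernel-checked.  PROVED here (es):
edges 147 ⟹ 139 (`cmRootPartnerGammaOneLawTwo/Three_of_twin`, onto the tree's `CMRootPartnerGammaOneLawTwoLocal/ThreeLocal` of `CMPartnerLaw`),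
147 ⟹ 140^loc pointwise at two traceless primes (`partnerPeriodLaw(Three)_of_twinGammaOne`, via the tree's `gamma1LatticeEqOfTwoTracelessPrimes_holds`),
COR 45.K₂/K₃ (`not_two/three_dvd_maninConstant_on_cmClass_two/three_of_twinGammaOne`: C2/C3 on every CM class with a second traceless prime ⟸
E-147 ∧ E-es-133⁺ ∧ `CMTwinPrimitiveVector*` ∧ Faltings), COR 45.R₂ (`not_two_dvd_maninConstant_on_cmClass_two_of_rootLaw256`).  BC5 =
HOME/es/g31/CM-PARTNER-v1.txt c1d2c7067b5b2e23 (39 classes, 820 Γ₁-periods, 189 ≠ 0, 0 violations; tight rows 64a / A = −3 / 36a).  FALSIFIER: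
one Γ₁-period D with v_π(D/Ω′_V) below the table bound.  No instances, no notation; imports = `CMPartnerLaw` + HarnessLib — ROUTE-INDEPENDENT.
NOT IN PRINT (nearest: Stevens 1989 Thm (7.1) at N ≤ 200 = tree fact `Stevens1989_thm_7_1_gamma1Lattice_conductor_le_200`; Rubin / Coates–Wiles
CM machinery is the mechanism, the lattice statements are the cell's).


THEOREM 45 (paper proof in HOME/MEMO-es.md §45; audit R-es-69 pending).  Let `V/ℚ` be a globally minimal CM curve
with `j = 1728` (`p = 2`, `K = ℚ(i)`) resp. `j = 0` (`p = 3`, `K = ℚ(√-3)`), `f` its newform of level `N`,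
`k := v₂(N) - 2` resp. `v₃(N) - 1` (`= v_π` of the conductor of the Grössencharacter), `ν := v_p(Δ_V)/12`,
`h_k := #Cl_K(π^k)`, `d_k := v_𝔭 disc(K(π^k)/K)`, `j_k := ⌊2 h_k ν⌋ + 1`.  Then for every generator
`D = {∞,b/ℓ} - {∞,b'/ℓ}` of `Λ₁(f)` (THM B′, `periodLatticeGamma1_eq_closure_balancedCuspDiffsPrime`),
`d := D/Ω'_V` satisfies `v_π(d) ≥ ⌊(j_k + d_k)/h_k⌋ - k`.  TABLE: `p = 2`: `32 ∥ N`: `v_π(d) ≥ -1`;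
`64 ∥ N`: `≥ -1`; `256 ∥ N`: `≥ 0`.  `p = 3`: `9 ∥ N`: `≥ 0`; `27 ∥ N`: `≥ -1`; `3⁵ ∥ N`: `≥ 0`.
Hence (i) the PARTNER law `Λ₁(f) ⊆ Λ(V') ⊗ ℤ_(p)` (`V'` = the `p`-isogenous CM partner, `Λ(V') = π⁻¹Λ(V)`) on
EVERY CM class — E-es-147₂/₃ below, which imply the tree conjectures E-es-139₂/₃
(`CMRootPartnerGammaOneLawTwoLocal/ThreeLocal`) and, at levels with two traceless primes, E-es-140₂/₃^loc pointwise,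
hence C2 / C3 on the CM slices through COR 44.K; (ii) the ROOT law `Λ₁(f) ⊆ Λ(V) ⊗ ℤ_(p)` (= the `p`-part of
Stevens' `Γ₁`-conjecture) on the strata `256 ∥ N` resp. `v₃(N) ≠ 3` — E-es-148₂ / E-es-149₃ below.
Everything tagged `@[conjecture]` here is a THEOREM CANDIDATE (paper proof, not yet kernel-checked); the edges are proved.
PARTITION 0 · beyond-print theorem: candidate (paper) · bears_on stmt-BirchSwinnertonDyer-22967 / 22968 · BSD is not proved by this.
-/

set_option autoImplicit false

noncomputable section

namespace Summit.BirchSwinnertonDyer.Rank1Residual.ManinAdditive.KatoCurve.CMTwinMinimal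

open scoped MatrixGroups ModularForm
open CongruenceSubgroup WeierstrassCurve Literature.NumberTheory.EllipticCurves
  Literature.NumberTheory.EllipticCurves.ModularForms
  Summit.BirchSwinnertonDyer.Rank1Residual.ManinAdditive.KatoCurve.CMOptimal

section EsG31

/-! ## §45.1 `j`-invariant glue: `c₆ = 0 ⟹ j = 1728`, `c₄ = 0 ⟹ j = 0` — the tree already has these as
`Summit.BirchSwinnertonDyer.Rank1Residual.X12.j_eq_1728_of_c₆_eq_zero` / `…j_eq_zero_of_c₄_eq_zero` (InertCoreInstancesA, an unrelated
import cone), so es's two copies are DEMOTED to local `have`s inside their three users below (typer; gate dedup). -/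

/-! ## §45.2 E-es-147₂ / 147₃ — the TWIN `Γ₁` PARTNER LAWS (THEOREM 45 (i); no root / twist-reduced binder:
for a globally minimal `V` with `c₆ = 0` a globally minimal isogenous `V'` with `c₄(V') = -4·c₄(V)`, `c₆(V') = 0`
exists iff `V` is the small twin `y² = x³ + Ax`, `v₂(A) ≤ 1`; otherwise the statement is vacuous). -/

/-- **E-es-147₂ (cell `bsd-f2-manin`, THEOREM 45 (i), `p = 2`).**  For every globally minimal `V/ℚ` with
`c₆(V) = 0` (`j = 1728`), newform `f`, and globally minimal isogenous `V'` with `c₄(V') = -4·c₄(V)`, `c₆(V') = 0`: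
`Λ₁(f) ⊆ Λ(V') ⊗ ℤ_(2)`.  Paper proof: CM class formula + ray-class trace + different bound (MEMO-es §45);
BC5: census CM-PARTNER-v1 (HOME/es/g31), 25/25 classes, 0 violations. -/
@[conjecture]
def CMTwinGammaOneLawTwoLocal : Prop :=
  ∀ (V V' : WeierstrassCurve ℚ) [V.IsElliptic] [V.IsGloballyMinimal] [V'.IsElliptic] [V'.IsGloballyMinimal]
    {N : ℕ} [NeZero N] (f : CuspForm (Gamma0 N) 2) (L' : PeriodPair),
    V.c₆ = 0 → IsNewformOf V f → WeierstrassCurve.IsIsogenous V V' → V'.c₄ = -4 * V.c₄ → V'.c₆ = 0 →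
    IsNeronLatticeOf (V'.baseChange ℂ) L' →
    ∀ z ∈ periodLatticeGamma1 f, ∃ s : ℤ, ¬ (2 : ℤ) ∣ s ∧ (s : ℂ) * z ∈ L'.lattice

/-- **E-es-147₃ (THEOREM 45 (i), `p = 3`).**  For every globally minimal `V/ℚ` with `c₄(V) = 0` (`j = 0`),
newform `f`, and globally minimal isogenous `V'` with `c₄(V') = 0`, `c₆(V') = -27·c₆(V)`:
`Λ₁(f) ⊆ Λ(V') ⊗ ℤ_(3)`. -/
@[conjecture]
def CMTwinGammaOneLawThreeLocal : Prop :=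
  ∀ (V V' : WeierstrassCurve ℚ) [V.IsElliptic] [V.IsGloballyMinimal] [V'.IsElliptic] [V'.IsGloballyMinimal]
    {N : ℕ} [NeZero N] (f : CuspForm (Gamma0 N) 2) (L' : PeriodPair),
    V.c₄ = 0 → IsNewformOf V f → WeierstrassCurve.IsIsogenous V V' → V'.c₄ = 0 → V'.c₆ = -27 * V.c₆ →
    IsNeronLatticeOf (V'.baseChange ℂ) L' →
    ∀ z ∈ periodLatticeGamma1 f, ∃ s : ℤ, ¬ (3 : ℤ) ∣ s ∧ (s : ℂ) * z ∈ L'.lattice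

/-! ## §45.3 E-es-148₂ / 149₃ — the ROOT LAWS on the `δ = 0` strata (THEOREM 45 (ii) = `p`-part of Stevens'
`Γ₁`-conjecture there): `Λ₁(f) ⊆ Λ(V) ⊗ ℤ_(p)` for EVERY globally minimal CM model `V` of the class. -/

/-- **E-es-148₂ (THEOREM 45 (ii), `p = 2`, stratum `2⁸ ∣ N`).**  `c₆(V) = 0`, `2⁸ ∣ N` ⟹ `Λ₁(f) ⊆ Λ(V) ⊗ ℤ_(2)`. -/
@[conjecture]
def CMGammaOneRootLawTwoLocalAt256 : Prop :=
  ∀ (V : WeierstrassCurve ℚ) [V.IsElliptic] [V.IsGloballyMinimal] {N : ℕ} [NeZero N]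
    (f : CuspForm (Gamma0 N) 2) (L : PeriodPair),
    V.c₆ = 0 → IsNewformOf V f → 2 ^ 8 ∣ N → IsNeronLatticeOf (V.baseChange ℂ) L →
    ∀ z ∈ periodLatticeGamma1 f, ∃ s : ℤ, ¬ (2 : ℤ) ∣ s ∧ (s : ℂ) * z ∈ L.lattice

/-- **E-es-149₃ (THEOREM 45 (ii), `p = 3`, strata `v₃(N) ∉ {3, 4}`).**  `c₄(V) = 0`, `¬ 3³ ∣ N ∨ 3⁵ ∣ N`
⟹ `Λ₁(f) ⊆ Λ(V) ⊗ ℤ_(3)`. -/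
@[conjecture]
def CMGammaOneRootLawThreeLocalOff27 : Prop :=
  ∀ (V : WeierstrassCurve ℚ) [V.IsElliptic] [V.IsGloballyMinimal] {N : ℕ} [NeZero N]
    (f : CuspForm (Gamma0 N) 2) (L : PeriodPair),
    V.c₄ = 0 → IsNewformOf V f → (¬ 3 ^ 3 ∣ N ∨ 3 ^ 5 ∣ N) → IsNeronLatticeOf (V.baseChange ℂ) L →
    ∀ z ∈ periodLatticeGamma1 f, ∃ s : ℤ, ¬ (3 : ℤ) ∣ s ∧ (s : ℂ) * z ∈ L.lattice

/-! ## §45.4 PROVED EDGES: 147 ⟹ 139 (tree conjectures), 147 ⟹ 140^loc pointwise at two traceless primes,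
and the C2 / C3 kernels from 147 (COR 45.K). -/

/-- E-es-147₂ ⟹ E-es-139₂ (`CMRootPartnerGammaOneLawTwoLocal`, tree, `@[conjecture]`): drop the root binder. -/
theorem cmRootPartnerGammaOneLawTwo_of_twin (h : CMTwinGammaOneLawTwoLocal) :
    CMRootPartnerGammaOneLawTwoLocal := by
  intro V V' _ _ _ _ N _ f L' hroot hf hiso' hc₄ hc₆ hL'
  obtain ⟨a, -, -, h6⟩ := hroot
  exact h V V' f L' h6 hf hiso' hc₄ hc₆ hL'

/-- E-es-147₃ ⟹ E-es-139₃ (`CMRootPartnerGammaOneLawThreeLocal`). -/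
theorem cmRootPartnerGammaOneLawThree_of_twin (h : CMTwinGammaOneLawThreeLocal) :
    CMRootPartnerGammaOneLawThreeLocal := by
  intro V V' _ _ _ _ N _ f L' hroot hf hiso' hc₄ hc₆ hL'
  obtain ⟨B, -, h4, -⟩ := hroot
  exact h V V' f L' h4 hf hiso' hc₄ hc₆ hL'

variable {N : ℕ} [NeZero N]

/-- E-es-147₂ ⟹ the partner period-lattice law (conclusion of E-es-140₂^loc) POINTWISE at every level with two
traceless primes (`Λ₁ = Λ₀`, tree theorem `gamma1LatticeEqOfTwoTracelessPrimes_holds`). -/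
theorem partnerPeriodLaw_of_twinGammaOne (h : CMTwinGammaOneLawTwoLocal)
    (V V' : WeierstrassCurve ℚ) [V.IsElliptic] [V.IsGloballyMinimal] [V'.IsElliptic] [V'.IsGloballyMinimal]
    (f : CuspForm (Gamma0 N) 2) (L' : PeriodPair) (h6 : V.c₆ = 0)
    (hf : IsNewformOf V f) (hiso' : WeierstrassCurve.IsIsogenous V V') (hc₄ : V'.c₄ = -4 * V.c₄)
    (hc₆ : V'.c₆ = 0) (hL' : IsNeronLatticeOf (V'.baseChange ℂ) L')
    {p q : ℕ} (hp : p.Prime) (hq : q.Prime) (hne : p ≠ q) (hp2 : p ^ 2 ∣ N) (hq2 : q ^ 2 ∣ N) :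
    ∀ γ : Gamma0 N, ∃ s : ℤ, ¬ (2 : ℤ) ∣ s ∧ (s : ℂ) * cuspSymbol f γ ∈ L'.lattice := by
  intro γ
  have heq := ModularForms.gamma1LatticeEqOfTwoTracelessPrimes_holds N f hf.1 p q hp hq hne
    ((dvd_pow_self p two_ne_zero).trans hp2) ((dvd_pow_self q two_ne_zero).trans hq2)
    (hf.1.cuspCoeff_eq_zero_of_sq_dvd hp hp2) (hf.1.cuspCoeff_eq_zero_of_sq_dvd hq hq2)
  have hmem : cuspSymbol f γ ∈ periodLatticeGamma1 f := by
    rw [heq]; unfold periodLattice; exact AddSubgroup.subset_closure ⟨γ, rfl⟩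
  exact h V V' f L' h6 hf hiso' hc₄ hc₆ hL' _ hmem

/-- Same for `p = 3`. -/
theorem partnerPeriodLawThree_of_twinGammaOne (h : CMTwinGammaOneLawThreeLocal)
    (V V' : WeierstrassCurve ℚ) [V.IsElliptic] [V.IsGloballyMinimal] [V'.IsElliptic] [V'.IsGloballyMinimal]
    (f : CuspForm (Gamma0 N) 2) (L' : PeriodPair) (h4 : V.c₄ = 0)
    (hf : IsNewformOf V f) (hiso' : WeierstrassCurve.IsIsogenous V V') (hc₄ : V'.c₄ = 0)
    (hc₆ : V'.c₆ = -27 * V.c₆) (hL' : IsNeronLatticeOf (V'.baseChange ℂ) L')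
    {p q : ℕ} (hp : p.Prime) (hq : q.Prime) (hne : p ≠ q) (hp2 : p ^ 2 ∣ N) (hq2 : q ^ 2 ∣ N) :
    ∀ γ : Gamma0 N, ∃ s : ℤ, ¬ (3 : ℤ) ∣ s ∧ (s : ℂ) * cuspSymbol f γ ∈ L'.lattice := by
  intro γ
  have heq := ModularForms.gamma1LatticeEqOfTwoTracelessPrimes_holds N f hf.1 p q hp hq hne
    ((dvd_pow_self p two_ne_zero).trans hp2) ((dvd_pow_self q two_ne_zero).trans hq2)
    (hf.1.cuspCoeff_eq_zero_of_sq_dvd hp hp2) (hf.1.cuspCoeff_eq_zero_of_sq_dvd hq hq2)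
  have hmem : cuspSymbol f γ ∈ periodLatticeGamma1 f := by
    rw [heq]; unfold periodLattice; exact AddSubgroup.subset_closure ⟨γ, rfl⟩
  exact h V V' f L' h4 hf hiso' hc₄ hc₆ hL' _ hmem

/-- **COR 45.K₂ (C2 on every `ℚ(i)`-CM class at a level with a second traceless prime, from E-es-147₂).**
Inputs: the twin `Γ₁`-law (THEOREM 45 (i), paper), E-es-133⁺₂ `CMTwinStevensMinimalTwo` (conjecture binder),
the primitive-vector support, Faltings (`LFunction_eq_of_isIsogenous`). -/
theorem not_two_dvd_maninConstant_on_cmClass_two_of_twinGammaOne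
    (h147 : CMTwinGammaOneLawTwoLocal) (hmin : CMTwinStevensMinimalTwo) (hprim : CMTwinPrimitiveVectorTwo)
    (hL : LFunction_eq_of_isIsogenous)
    (W : WeierstrassCurve ℚ) [W.IsElliptic] [W.IsGloballyMinimal]
    (D : ModularParametrizationData W N)
    (hD : ∀ z ∈ D.L.lattice, ∃ w ∈ periodLattice D.f, z = D.c * w)
    (V V' : WeierstrassCurve ℚ) [V.IsElliptic] [V.IsGloballyMinimal] [V'.IsElliptic] [V'.IsGloballyMinimal]
    (LV L' : PeriodPair) (h6 : V.c₆ = 0) (hiso : WeierstrassCurve.IsIsogenous V W)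
    (hiso' : WeierstrassCurve.IsIsogenous V V') (hc₄ : V'.c₄ = -4 * V.c₄) (hc₆ : V'.c₆ = 0)
    (hLV : IsNeronLatticeOf (V.baseChange ℂ) LV) (hL' : IsNeronLatticeOf (V'.baseChange ℂ) L')
    (hred : ∀ (W' : WeierstrassCurve ℚ) [W'.IsElliptic] [W'.IsGloballyMinimal],
        W'.j = 1728 → WeierstrassCurve.IsIsogenous V W' → (W'.c₄ = V.c₄ ∨ W'.c₄ = -4 * V.c₄))
    {q : ℕ} (hq : q.Prime) (hq2 : q ≠ 2) (h4 : 2 ^ 2 ∣ N) (hqN : q ^ 2 ∣ N) :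
    ¬ (2 : ℤ) ∣ D.maninConstant := by
  have hjV : V.j = 1728 := by
    have hΔ : V.Δ ≠ 0 := by rw [← WeierstrassCurve.coe_Δ']; exact V.Δ'.ne_zero
    have hc : V.c₄ ^ 3 = 1728 * V.Δ := by
      have := V.c_relation; rw [h6] at this; linear_combination -this
    rw [WeierstrassCurve.j, Units.val_inv_eq_inv_val, WeierstrassCurve.coe_Δ', hc]
    field_simp
  obtain ⟨z, hz, hzM⟩ := hprim V V' LV L' hjV hiso' hc₄ hc₆ hLV hL'
  refine not_dvd_maninConstant_of_saturated_mem_of_witness D hD Int.prime_two L'.lattice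
    (partnerPeriodLaw_of_twinGammaOne h147 V V' D.f L' h6 (isNewformOf_of_isIsogenous hL D.isNewformOf hiso)
      hiso' hc₄ hc₆ hL' Nat.prime_two hq (Ne.symm hq2) h4 hqN)
    ⟨z, hmin V W LV D.L hjV hiso hLV D.isNeronLattice hred hz, fun s hs m hm => ?_⟩
  exact_mod_cast hzM s hs m hm


/-- **COR 45.K₃ (C3 on every `ℚ(√-3)`-CM class at a level with a second traceless prime, from E-es-147₃).** -/
theorem not_three_dvd_maninConstant_on_cmClass_three_of_twinGammaOne
    (h147 : CMTwinGammaOneLawThreeLocal) (hmin : CMTwinStevensMinimalThree)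
    (hprim : CMTwinPrimitiveVectorThree) (hL : LFunction_eq_of_isIsogenous)
    (W : WeierstrassCurve ℚ) [W.IsElliptic] [W.IsGloballyMinimal]
    (D : ModularParametrizationData W N)
    (hD : ∀ z ∈ D.L.lattice, ∃ w ∈ periodLattice D.f, z = D.c * w)
    (V V' : WeierstrassCurve ℚ) [V.IsElliptic] [V.IsGloballyMinimal] [V'.IsElliptic] [V'.IsGloballyMinimal]
    (LV L' : PeriodPair) (h4 : V.c₄ = 0) (hiso : WeierstrassCurve.IsIsogenous V W)
    (hiso' : WeierstrassCurve.IsIsogenous V V') (hc₄ : V'.c₄ = 0) (hc₆ : V'.c₆ = -27 * V.c₆)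
    (hLV : IsNeronLatticeOf (V.baseChange ℂ) LV) (hL' : IsNeronLatticeOf (V'.baseChange ℂ) L')
    (hred : ∀ (W' : WeierstrassCurve ℚ) [W'.IsElliptic] [W'.IsGloballyMinimal],
        W'.j = 0 → WeierstrassCurve.IsIsogenous V W' → (W'.c₆ = V.c₆ ∨ W'.c₆ = -27 * V.c₆))
    {q : ℕ} (hq : q.Prime) (hq3 : q ≠ 3) (h9 : 3 ^ 2 ∣ N) (hqN : q ^ 2 ∣ N) :
    ¬ (3 : ℤ) ∣ D.maninConstant := by
  have hjV : V.j = 0 := by simp [WeierstrassCurve.j, h4]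
  obtain ⟨z, hz, hzM⟩ := hprim V V' LV L' hjV hiso' hc₄ hc₆ hLV hL'
  refine not_dvd_maninConstant_of_saturated_mem_of_witness D hD Int.prime_three L'.lattice
    (partnerPeriodLawThree_of_twinGammaOne h147 V V' D.f L' h4
      (isNewformOf_of_isIsogenous hL D.isNewformOf hiso) hiso' hc₄ hc₆ hL' Nat.prime_three hq (Ne.symm hq3) h9 hqN)
    ⟨z, hmin V W LV D.L hjV hiso hLV D.isNeronLattice hred hz, fun s hs m hm => ?_⟩
  exact_mod_cast hzM s hs m hm

/-- **COR 45.R₂ (C2 from the ROOT law E-es-148₂ on the stratum `2⁸ ∣ N`, no partner curve):** the witness is any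
vector of `Λ(V)` not in `2·Λ(V) ⊗ ℤ_(2)` (hypothesis `hwit`, trivially available from a basis). -/
theorem not_two_dvd_maninConstant_on_cmClass_two_of_rootLaw256
    (h148 : CMGammaOneRootLawTwoLocalAt256) (hmin : CMTwinStevensMinimalTwo) (hL : LFunction_eq_of_isIsogenous)
    (W : WeierstrassCurve ℚ) [W.IsElliptic] [W.IsGloballyMinimal]
    (D : ModularParametrizationData W N)
    (hD : ∀ z ∈ D.L.lattice, ∃ w ∈ periodLattice D.f, z = D.c * w)
    (V : WeierstrassCurve ℚ) [V.IsElliptic] [V.IsGloballyMinimal] (LV : PeriodPair) (h6 : V.c₆ = 0)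
    (hiso : WeierstrassCurve.IsIsogenous V W) (hLV : IsNeronLatticeOf (V.baseChange ℂ) LV)
    (hred : ∀ (W' : WeierstrassCurve ℚ) [W'.IsElliptic] [W'.IsGloballyMinimal],
        W'.j = 1728 → WeierstrassCurve.IsIsogenous V W' → (W'.c₄ = V.c₄ ∨ W'.c₄ = -4 * V.c₄))
    (hwit : ∃ z ∈ LV.lattice, ∀ s : ℤ, ¬ (2 : ℤ) ∣ s → ∀ m ∈ LV.lattice, (s : ℂ) * z ≠ 2 * m)
    {q : ℕ} (hq : q.Prime) (hq2 : q ≠ 2) (h256 : 2 ^ 8 ∣ N) (hqN : q ^ 2 ∣ N) :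
    ¬ (2 : ℤ) ∣ D.maninConstant := by
  have hjV : V.j = 1728 := by
    have hΔ : V.Δ ≠ 0 := by rw [← WeierstrassCurve.coe_Δ']; exact V.Δ'.ne_zero
    have hc : V.c₄ ^ 3 = 1728 * V.Δ := by
      have := V.c_relation; rw [h6] at this; linear_combination -this
    rw [WeierstrassCurve.j, Units.val_inv_eq_inv_val, WeierstrassCurve.coe_Δ', hc]
    field_simp
  have hfV : IsNewformOf V D.f := isNewformOf_of_isIsogenous hL D.isNewformOf hiso
  have h4 : 2 ^ 2 ∣ N := (pow_dvd_pow 2 (by norm_num : 2 ≤ 8)).trans h256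
  have heq := ModularForms.gamma1LatticeEqOfTwoTracelessPrimes_holds N D.f hfV.1 2 q Nat.prime_two hq
    (Ne.symm hq2) ((dvd_pow_self 2 two_ne_zero).trans h4) ((dvd_pow_self q two_ne_zero).trans hqN)
    (hfV.1.cuspCoeff_eq_zero_of_sq_dvd Nat.prime_two h4) (hfV.1.cuspCoeff_eq_zero_of_sq_dvd hq hqN)
  obtain ⟨z, hz, hzM⟩ := hwit
  refine not_dvd_maninConstant_of_saturated_mem_of_witness D hD Int.prime_two LV.lattice
    (fun γ => h148 V D.f LV h6 hfV h256 hLV _ ?_)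
    ⟨z, hmin V W LV D.L hjV hiso hLV D.isNeronLattice hred hz, fun s hs m hm => ?_⟩
  · rw [heq]; unfold periodLattice; exact AddSubgroup.subset_closure ⟨γ, rfl⟩
  · exact_mod_cast hzM s hs m hm

end EsG31

end Summit.BirchSwinnertonDyer.Rank1Residual.ManinAdditive.KatoCurve.CMTwinMinimal

end
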